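import Literature.AlgebraicGeometry.Resolution.CartierDivisorReduced
import Literature.AlgebraicGeometry.Resolution.NonPrincipalLocus
import Literature.AlgebraicGeometry.Resolution.OrderSemicontinuity
import Literature.Topology.KrullDimensionDrop
import Literature.AlgebraicGeometry.Resolution.RegularCentreComponents
import Literature.AlgebraicGeometry.Resolution.StrictNormalCrossingsHasSNC
import Literature.AlgebraicGeometry.Resolution.BlowupRestrictOpen
import Literature.AlgebraicGeometry.Resolution.EmbeddedResolutionExcellentSurfacesSequence
import HarnessLib

/-!
# Crux `PatchingRelPerfect` (stmt-ResolutionOfSingularities-16161), chain W5.2 — TargetsF6 stage 1, T6-E1a «DIVISORIAL PRE-PHASE»: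
# the BAD DIVISORIAL SET of a flag (the closed set the Cossart–Jannsen–Saito run is applied to)

[OURS · L1 W5.2 · TargetsF6 v1 c3ff68005e5acf4d §1, T6-E1a `StageOnePrephase₃` (res-type-049), brick 3a/4] Fact-free; NOT statements of the
manuscript under review.

For a flag `𝔟 ≤ R₁` on a regular integral Noetherian scheme `E` (`𝔟 ≠ ⊥` locally principal) the BAD prime divisors are the
`cl{ζ}` with `ζ` of codimension one, `ord_ζ 𝔟 ≥ 2` and `ζ ∈ V(R₁)` — finitely many, inside the codimension-one points of `V(𝔟)`
(Cossart–Piltant 2008, proof of Prop. 4.2; tree `finite_divisorialPoints`). Their union `X` is a proper closed subset — of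
dimension `≤ 2` when `dim E = 3` — with `R₁ ⊆ 𝓘(X)` and, by the divisorial factorisation `𝔟 = ∏_ζ 𝓟_ζ^{a(ζ)}` read stalkwise with
COMMON prime generators (tree `exists_primes_stalkIdeal_divisorialPart_eq'`), `𝔟 ⊆ (∏_{bad} 𝓟_ζ)² ⊆ 𝓘(X)²`: the two containments
under which every Cossart–Jannsen–Saito centre over `X` is flag-permissible (brick 2, `DepthFlagCJS.cjs_flag_transport`).

* `exists_badSet` — the bad set with all its bookkeeping.

AI-written; AI review is weaker than expert review.

## References
* V. Cossart, O. Piltant, J. Algebra 320 (2008), proof of Prop. 4.2. [CossartPiltant2008]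
* The Stacks Project, Tags 0BE1, 01J7. [StacksProject]
-/

-- `Summit.<Summit>.<Sub>.Theorems` with `Sub = Summit` (single-conjunct summit, D-0017)
set_option linter.dupNamespace false

noncomputable section

open CategoryTheory CategoryTheory.Limits AlgebraicGeometry TopologicalSpace IsLocalRing
open Literature.AlgebraicGeometry.Resolution Scheme.IdealSheafData

namespace Summit.ResolutionOfSingularities.ResolutionOfSingularities.Theorems

universe u

namespace DepthFlagBad

variable {E : Scheme.{u}}

/-- Squares are monotone. [folklore] -/
private theorem sq_le_sq {K L : E.IdealSheafData} (h : K ≤ L) : K ^ 2 ≤ L ^ 2 := by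
  rw [pow_two, pow_two]
  exact Scheme.IdealSheafData.le_def.mpr fun U => by
    rw [Scheme.IdealSheafData.ideal_mul, Scheme.IdealSheafData.ideal_mul, Pi.mul_apply, Pi.mul_apply]
    exact Ideal.mul_mono (h U) (h U)

variable [IsIntegral E] [IsNoetherian E]

/-- **`𝔟 ⊆ (∏_{ζ ∈ S} 𝓟_ζ)²` for any finite set `S` of codimension-one points at which `ord_ζ 𝔟 ≥ 2`** (`E` regular integral
Noetherian, `𝔟 ≠ ⊥` locally principal): stalkwise, `𝔟_x = (∏_ζ q_ζ^{a(ζ)})` over the codimension-one generisations of `x` in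
`V(𝔟)` and `(𝓟_ζ)_x = (q_ζ)` with the same primes. [cite: CossartPiltant2008, proof of Prop. 4.2] -/
theorem le_prod_primeDivisorIdeal_sq (hE : Scheme.IsRegular E) {𝔟 : E.IdealSheafData} (h𝔟 : 𝔟 ≠ ⊥)
    (hlp : IsLocallyPrincipal 𝔟) (S : Finset E) (hS : ∀ ζ ∈ S, Order.coheight ζ = 1 ∧ (2 : ℕ∞) ≤ idealOrder 𝔟 ζ) :
    𝔟 ≤ (∏ ζ ∈ S, primeDivisorIdeal ζ) ^ 2 := by
  classical
  rw [← Finset.prod_pow]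
  refine le_of_forall_stalkIdeal_le fun x => ?_
  obtain ⟨T, q, hTdiv, hdivT, -, -, hst, h𝔟x⟩ := exists_primes_stalkIdeal_divisorialPart_eq' hE h𝔟 x
  rw [divisorialPart_eq_self_of_isLocallyPrincipal hE h𝔟 hlp] at h𝔟x
  -- bad points of `S` that are in `V(𝔟)` with codimension one are divisorial; those specialising to `x` lie in `T`
  have hSdiv : ∀ ζ ∈ S, ζ ∈ divisorialPoints 𝔟 := fun ζ hζ =>
    ⟨(one_le_idealOrder_iff 𝔟 ζ).mp (le_trans (by decide) (hS ζ hζ).2), (hS ζ hζ).1⟩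
  -- the stalk of `∏_{S} 𝓟_ζ²` only sees `S ∩ T`
  have hprod : stalkIdeal (∏ ζ ∈ S, primeDivisorIdeal ζ ^ 2) x = Ideal.span {∏ ζ ∈ S ∩ T, q ζ ^ 2} := by
    rw [stalkIdeal_finset_prod, ← Ideal.prod_span_singleton]
    rw [← Finset.prod_subset (Finset.inter_subset_left (s₂ := T)) ?_]
    · refine Finset.prod_congr rfl fun ζ hζ => ?_
      rw [stalkIdeal_pow, hst ζ (Finset.mem_inter.mp hζ).2, Ideal.span_singleton_pow]
    · intro ζ hζS hζST
      have hζT : ζ ∉ T := fun h => hζST (Finset.mem_inter.mpr ⟨hζS, h⟩)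
      have hnsp : ¬ ζ ⤳ x := fun h => hζT (hdivT ζ (hSdiv ζ hζS) h)
      rw [stalkIdeal_pow, stalkIdeal_primeDivisorIdeal_eq_top hnsp, Ideal.one_eq_top, Ideal.top_pow]
  rw [h𝔟x, hprod, Ideal.span_singleton_le_span_singleton]
  -- `∏_{S ∩ T} q² ∣ ∏_{S ∩ T} q^{a} ∣ ∏_{T} q^{a}`
  refine dvd_trans (Finset.prod_dvd_prod_of_dvd _ _ fun ζ hζ => ?_)
    (Finset.prod_dvd_prod_of_subset _ _ _ Finset.inter_subset_right)
  refine pow_dvd_pow _ ?_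
  have h2 := (hS ζ (Finset.mem_inter.mp hζ).1).2
  have hfin : idealOrder 𝔟 ζ ≠ ⊤ := idealOrder_ne_top h𝔟 ζ
  obtain ⟨m, hm⟩ := ENat.ne_top_iff_exists.mp hfin
  rw [← hm] at h2 ⊢
  simp only [ENat.toNat_coe]
  exact_mod_cast h2

/-- **THE BAD SET OF A FLAG.** For a flag `𝔟 ≤ R₁` (`𝔟 ≠ ⊥` locally principal) on a regular integral Noetherian scheme of
dimension three there is a closed subset `X` of dimension `≤ 2` (the union of the bad prime divisors) with `R₁ ⊆ 𝓘(X)`,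
`𝔟 ⊆ 𝓘(X)²`, containing every bad codimension-one point, and contained in `V(𝔟)`. [cite: CossartPiltant2008, proof of Prop. 4.2] -/
theorem exists_badSet (hE : Scheme.IsRegular E) (hdim : topologicalKrullDim E = 3) {𝔟 R₁ : E.IdealSheafData} (h𝔟 : 𝔟 ≠ ⊥)
    (hlp : IsLocallyPrincipal 𝔟) :
    ∃ X : Closeds E, topologicalKrullDim (X : Set E) ≤ 2 ∧ (X : Set E) ⊆ 𝔟.support ∧
      𝔟 ≤ vanishingIdeal X ^ 2 ∧ R₁ ≤ vanishingIdeal X ∧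
      (∀ ζ : E, Order.coheight ζ = 1 → (2 : ℕ∞) ≤ idealOrder 𝔟 ζ → ζ ∈ R₁.support → ζ ∈ (X : Set E)) := by
  classical
  -- the finite set of bad codimension-one points
  set Bset : Set E := {ζ | Order.coheight ζ = 1 ∧ (2 : ℕ∞) ≤ idealOrder 𝔟 ζ ∧ ζ ∈ R₁.support} with hBset
  have hBfin : Bset.Finite := (finite_divisorialPoints h𝔟).subset fun ζ hζ =>
    ⟨(one_le_idealOrder_iff 𝔟 ζ).mp (le_trans (by decide) hζ.2.1), hζ.1⟩
  set S := hBfin.toFinset with hSdef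
  have hSmem : ∀ ζ, ζ ∈ S ↔ ζ ∈ Bset := fun ζ => Set.Finite.mem_toFinset _
  set Xs : Set E := ⋃ ζ ∈ S, closure {ζ} with hXs
  have hXc : IsClosed Xs := isClosed_biUnion_finset fun _ _ => isClosed_closure
  let X : Closeds E := ⟨Xs, hXc⟩
  -- `X ⊆ V(𝔟)` and `X ⊆ V(R₁)`
  have hX𝔟 : (X : Set E) ⊆ 𝔟.support := by
    refine Set.iUnion₂_subset fun ζ hζ => closure_minimal (Set.singleton_subset_iff.mpr ?_) 𝔟.support.isClosed
    exact (one_le_idealOrder_iff 𝔟 ζ).mp (le_trans (by decide) ((hSmem ζ).mp hζ).2.1)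
  have hXR : (X : Set E) ⊆ R₁.support := by
    refine Set.iUnion₂_subset fun ζ hζ => closure_minimal (Set.singleton_subset_iff.mpr ?_) R₁.support.isClosed
    exact ((hSmem ζ).mp hζ).2.2
  -- dimension `≤ 2`: a proper closed subset of the integral threefold
  have hXne : (X : Set E) ≠ Set.univ := fun hX =>
    not_mem_support_genericPoint h𝔟 (hX𝔟 (show genericPoint E ∈ (X : Set E) from hX ▸ Set.mem_univ _))
  have hdimX : topologicalKrullDim (X : Set E) ≤ 2 := by
    have hlt := Literature.Topology.topologicalKrullDim_lt_of_isClosed_ssubset hXc hXne (2 + 1)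
      (by rw [hdim]; exact_mod_cast (by norm_num : (3 : ℕ) < 2 + 1 + 1))
    rw [Nat.cast_add_one] at hlt
    exact_mod_cast (ENat.WithBot.lt_add_one_iff.mp hlt)
  -- `∏_{S} 𝓟_ζ ≤ 𝓘(X)` through supports, and `𝔟 ≤ (∏ 𝓟_ζ)²`
  have hprodX : (∏ ζ ∈ S, primeDivisorIdeal ζ) ≤ vanishingIdeal X := by
    rw [← Scheme.IdealSheafData.le_support_iff_le_vanishingIdeal]
    change Xs ⊆ ((∏ ζ ∈ S, primeDivisorIdeal ζ).support : Set E)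
    refine Set.iUnion₂_subset fun ζ hζ => ?_
    have hle : (∏ ζ ∈ S, primeDivisorIdeal ζ) ≤ primeDivisorIdeal ζ := by
      rw [← Finset.mul_prod_erase S _ hζ]
      exact Scheme.IdealSheafData.le_def.mpr fun U => by
        rw [Scheme.IdealSheafData.ideal_mul, Pi.mul_apply]; exact Ideal.mul_le_right
    refine (closure_minimal (Set.singleton_subset_iff.mpr ?_) (primeDivisorIdeal ζ).support.isClosed).trans
      (Scheme.IdealSheafData.support_antitone hle)
    exact (mem_support_primeDivisorIdeal_iff ζ ζ).mpr (specializes_refl ζ)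
  have h𝔟prod : 𝔟 ≤ (∏ ζ ∈ S, primeDivisorIdeal ζ) ^ 2 :=
    le_prod_primeDivisorIdeal_sq hE h𝔟 hlp S fun ζ hζ => ⟨((hSmem ζ).mp hζ).1, ((hSmem ζ).mp hζ).2.1⟩
  refine ⟨X, hdimX, hX𝔟, h𝔟prod.trans (sq_le_sq hprodX), ?_, fun ζ h1 h2 h3 => ?_⟩
  · rw [← Scheme.IdealSheafData.le_support_iff_le_vanishingIdeal]; exact hXR
  · exact Set.mem_iUnion₂.mpr ⟨ζ, (hSmem ζ).mpr ⟨h1, h2, h3⟩, subset_closure rfl⟩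

/-! ## §2 After the Cossart–Jannsen–Saito run: every bad prime divisor is regular -/

omit [IsIntegral E] in
/-- **A codimension-one point lying on a REGULAR proper closed subscheme `V(I)` is the generic point of a component of `V(I)`,
so its prime divisor `cl{ζ}` is one of the (regular) components**: `IsRegular (𝓟_ζ).subscheme`.
[cite: StacksProject, Tag 0357] -/
theorem isRegular_primeDivisorIdeal_of_mem_support [IrreducibleSpace E] {I : E.IdealSheafData}
    (hI : Scheme.IsRegular I.subscheme) (hIne : (I.support : Set E) ≠ Set.univ) {ζ : E} (hζ : Order.coheight ζ = 1)
    (hζI : ζ ∈ (I.support : Set E)) : Scheme.IsRegular (primeDivisorIdeal ζ).subscheme := by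
  obtain ⟨Zs, hP, -, hirr, -, -, hreg, -⟩ := hI.exists_pieces
  -- the piece through `ζ`
  have hζU : ζ ∈ ⋃ Z ∈ Zs, (Z : Set E) := by rw [hP.2]; exact hζI
  obtain ⟨Z, hZ, hζZ⟩ := Set.mem_iUnion₂.mp hζU
  obtain ⟨η, hη⟩ := QuasiSober.sober (hirr Z hZ) Z.isClosed
  have hηζ : η ⤳ ζ := hη.specializes hζZ
  -- `η` is not the generic point (`Z ⊆ V(I) ≠ E`)
  have hη0 : Order.coheight η ≠ 0 := by
    intro h0
    have hgen : η = genericPoint E := eq_genericPoint_of_coheight_eq_zero h0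
    apply hIne
    refine Set.eq_univ_of_univ_subset ?_
    have hZI : (Z : Set E) ⊆ (I.support : Set E) := by
      rw [← hP.2]; exact Set.subset_iUnion₂ (s := fun (Z' : Closeds E) (_ : Z' ∈ Zs) => (Z' : Set E)) Z hZ
    rw [← (genericPoint_spec E).def, ← hgen, hη.def]
    exact hZI
  have hηeq : η = ζ := eq_of_specializes_of_coheight_le hηζ (by rw [hζ]; exact ENat.coe_ne_top 1)
    (by rw [hζ]; exact Order.one_le_iff_pos.mpr (pos_iff_ne_zero.mpr hη0))
  subst hηeq
  have hcl : (⟨closure {η}, isClosed_closure⟩ : Closeds E) = Z := Closeds.ext hη.def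
  change Scheme.IsRegular (vanishingIdeal ⟨closure {η}, isClosed_closure⟩).subscheme
  rw [hcl]
  exact hreg Z hZ

omit [IsIntegral E] [AlgebraicGeometry.IsNoetherian E] in
/-- Codimension is preserved under a morphism at a point where the stalk map is an isomorphism. [cite: StacksProject, Tag 02OS] -/
theorem coheight_eq_of_isIso_stalkMap {E' : Scheme.{u}} (π : E' ⟶ E) (y : E') [IsIso (π.stalkMap y)] :
    Order.coheight (π y) = Order.coheight y := by
  let e : E.presheaf.stalk (π y) ≃+* E'.presheaf.stalk y := (asIso (π.stalkMap y)).commRingCatIsoToRingEquiv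
  have h := ringKrullDim_eq_of_ringEquiv e
  rw [ringKrullDim_stalk_eq_coheight, ringKrullDim_stalk_eq_coheight] at h
  exact_mod_cast h

omit [IsIntegral E] [AlgebraicGeometry.IsNoetherian E] in
/-- **AFTER THE CJS RUN OVER THE BAD SET, EVERY BAD PRIME DIVISOR IS REGULAR.** With `π : Z₁ → E` surjective, `π⁻¹X = X₁ ∪ B₁`,
`V(𝓘(cl X₁))` regular, `B₁` a strict normal crossings divisor on the regular `Z₁`, and the transported flag `(𝔟₁, R₁,₁)` agreeing with
`(𝔟, R₁)` through stalk isomorphisms over `E ∖ X` (brick 2): a bad codimension-one point `ζ'` of `(𝔟₁, R₁,₁)` lies over `X` — otherwise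
`π ζ'` would be bad downstairs and hence in `X` — so on `cl X₁` or on `B₁`, whose components are regular prime divisors.
[cite: CossartJannsenSaito2020, Thm. 1.4] [cite: CossartPiltant2008, proof of Prop. 4.2] -/
theorem isRegular_bad_after_cjs {Z₁ : Scheme.{u}} [IsIntegral Z₁] [IsNoetherian Z₁] (hZ₁ : Scheme.IsRegular Z₁)
    {π : Z₁ ⟶ E} (hsurj : Function.Surjective π) {X : Set E} (hXc : IsClosed X) (hXne : X ≠ Set.univ)
    {𝔟 R₁ : E.IdealSheafData}
    (hbad : ∀ ζ : E, Order.coheight ζ = 1 → (2 : ℕ∞) ≤ idealOrder 𝔟 ζ → ζ ∈ R₁.support → ζ ∈ X)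
    {X₁ B₁ : Set Z₁} (htot : π ⁻¹' X = X₁ ∪ B₁)
    (hX₁ : Scheme.IsRegular (vanishingIdeal ⟨closure X₁, isClosed_closure⟩).subscheme)
    (hB₁ : IsStrictNormalCrossingsDivisor Z₁ B₁) {𝔟₁ R₁₁ : Z₁.IdealSheafData}
    (hstalk : ∀ y : Z₁, π y ∉ X → IsIso (π.stalkMap y) ∧ stalkIdeal 𝔟₁ y = stalkIdeal (𝔟.comap π) y ∧
      stalkIdeal R₁₁ y = stalkIdeal (R₁.comap π) y) :
    ∀ ζ' : Z₁, Order.coheight ζ' = 1 → (2 : ℕ∞) ≤ idealOrder 𝔟₁ ζ' → ζ' ∈ R₁₁.support →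
      Scheme.IsRegular (primeDivisorIdeal ζ').subscheme := by
  intro ζ' hζ' h2 hR
  -- the preimage of `X` is a proper closed subset
  have hpre : (π ⁻¹' X) ≠ Set.univ := by
    intro h
    apply hXne
    refine Set.eq_univ_of_forall fun x => ?_
    obtain ⟨y, rfl⟩ := hsurj x
    exact (h ▸ Set.mem_univ y : y ∈ π ⁻¹' X)
  by_cases hπζ : π ζ' ∈ X
  · have hmem : ζ' ∈ X₁ ∪ B₁ := htot ▸ hπζ
    rcases hmem with hX1 | hB1
    · -- on the strict transform
      refine isRegular_primeDivisorIdeal_of_mem_support hX₁ ?_ hζ' ?_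
      · rw [Scheme.IdealSheafData.coe_support_vanishingIdeal]
        intro h
        apply hpre
        refine Set.eq_univ_of_univ_subset ?_
        rw [← h]
        exact closure_minimal (htot.symm ▸ Set.subset_union_left) (hXc.preimage π.continuous)
      · rw [Scheme.IdealSheafData.coe_support_vanishingIdeal]; exact subset_closure hX1
    · -- on the boundary: a component of the strict normal crossings divisor
      obtain ⟨Es, hEs, hmem, -, hU⟩ := hB₁.exists_hasSNC hZ₁
      have hζU : ζ' ∈ ⋃ D ∈ Es, (D.support : Set Z₁) := by rw [hU]; exact hB1
      obtain ⟨D, hD, hζD⟩ := Set.mem_iUnion₂.mp hζU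
      have hDreg : Scheme.IsRegular D.subscheme := by
        have h := hEs.isRegular_subscheme_finsetSup {D} (fun K hK => by
          rw [Finset.mem_singleton] at hK; exact hK ▸ hD)
        rwa [Finset.sup_singleton, id] at h
      refine isRegular_primeDivisorIdeal_of_mem_support hDreg ?_ hζ' hζD
      intro h
      apply hpre
      refine Set.eq_univ_of_univ_subset ?_
      rw [← h]
      refine (Set.subset_iUnion₂ (s := fun (D' : Z₁.IdealSheafData) (_ : D' ∈ Es) => (D'.support : Set Z₁)) D hD).trans ?_
      rw [hU, htot]
      exact Set.subset_union_right
  · -- over `E ∖ X`: `π ζ'` would be bad downstairs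
    exfalso
    obtain ⟨hiso, h𝔟st, hRst⟩ := hstalk ζ' hπζ
    haveI := hiso
    apply hπζ
    refine hbad (π ζ') ?_ ?_ ?_
    · rw [coheight_eq_of_isIso_stalkMap π ζ']; exact hζ'
    · have h2' := (le_idealOrder_iff 𝔟₁ ζ' 2).mp (by exact_mod_cast h2)
      rw [h𝔟st, stalkIdeal_comap_le_maximalIdeal_pow_iff_of_isIso_stalkMap π 𝔟 ζ' 2] at h2'
      exact_mod_cast (le_idealOrder_iff 𝔟 (π ζ') 2).mpr h2'
    · rw [mem_support_iff_stalkIdeal_le] at hR ⊢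
      rw [hRst, ← pow_one (maximalIdeal _), stalkIdeal_comap_le_maximalIdeal_pow_iff_of_isIso_stalkMap π R₁ ζ' 1,
        pow_one] at hR
      exact hR

end DepthFlagBad

end Summit.ResolutionOfSingularities.ResolutionOfSingularities.Theorems

end
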